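import Mathlib
import HarnessLib
import Summits.FinalStateConjecture.Statement
import Summits.FinalStateConjecture.FinalStateConjecture.Theses.PhotonSphereChannels

/-!
# Route PhotonSphereChannels — the Assembly

The assembly item of route `PhotonSphereChannels` for the Final State Conjecture:

`UniformPhotonSphereChannels → ChannelsResolveTameDevelopments → TameCensorship → FinalStateConjecture`.

This is pure logic (no analysis): Christodoulou-genericity in curve form
(`IsChristodoulouGeneric … P 1`) is monotone in the property `P`, and the tame generic property of
`TameCensorship` implies the final-state property pointwise on admissible data —
`ChannelsResolveTameDevelopments`, fed with `UniformPhotonSphereChannels`, turns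
(complete 𝓘⁺ ∧ no extremal remnant ∧ bounded outer geometry) into an honest exhaustive
`FinalStateDecomposition`, and each of its holes is sub-extremal because `|aᵢ| ≤ Mᵢ` holds
structurally while `|aᵢ| = Mᵢ` would exhibit an extremal remnant, excluded by hypothesis.

The proof is the body of the route's deciding theorem `closes` with its three unused hypotheses
removed (candidate attached to item stmt-FinalStateConjecture-10050 by the route-review refuter).

**Repair 2026-08-16.** `assembly_proof` proved the rev-3 CURRIED assembly
`UniformPhotonSphereChannels → ChannelsResolveTameDevelopments → TameCensorship → FinalStateConjecture`
(item stmt-FinalStateConjecture-10050, closed `proved` by it at d725233c9ffd). The rev-4 repair of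
the route restated the item UNDER THE SAME DECL NAME `Assembly` in uncurried frame form
`UniformPhotonSphereChannels ∧ ChannelsResolveTameDevelopments ∧ TameCensorship → FinalStateConjecture`
(item stmt-FinalStateConjecture-13914, proved by the cycle-free
`Theorems.PhotonSphereChannels.assembly_frame_proof`, which the route file imports), so the old
proof script (`intro h₁ h₂ h₃ X …`) stopped elaborating against the new definiens. The theorem
keeps its name and statement text (Theorems files are append-only) and now proves the current
`Assembly` by the same argument, uncurried (`rintro ⟨h₁, h₂, h₃⟩ X …`). It is a second, dependent
proof of stmt-FinalStateConjecture-13914 and must NOT be used as that item's `Assembly_holds`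
link: this module imports the route module (see the warning in the route file's `Assembly`
docstring); `assembly_frame_proof` remains the closing theorem.

**Repair 2026-08-17 (full-build, dependency drift).** Route rev 15 (2026-08-16T23:19Z, route-repair
after the T2 re-type of the summit statement, p126844) restated the constituents of `Assembly` in
place — K1R `UniformPhotonSphereChannelsR`, K2R `ChannelsResolveTameDevelopmentsR` (consequent now with
the ray-closure, honest-exhaustiveness and future-orientation clauses) and K3 `TameCensorship` (now
TAME-Christodoulou-generic, `IsTameChristodoulouGeneric`) — again UNDER THE SAME DECL NAME `Assembly`
(item stmt-FinalStateConjecture-17432, closed by the Theses-free frame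
`Theorems.PhotonSphereChannels.assemblyT2_frame_proof`), so the rev-4 proof script below stopped
elaborating (`isChristodoulouGeneric_mono ?_ (h₃ X)`: `h₃ X` is now tame-generic). As before the
theorem keeps its name and statement text; its proof is now literally the uncurried deciding theorem
of the route, `closes h₁ h₂ h₃` (the route file's own description of the assembly item), which is the
same pure-logic argument (tame genericity is monotone in the property; sub-extremality of the holes
from `|aᵢ| ≤ Mᵢ` and the no-extremal-remnant clause) maintained by the planner inside the route file —
so this dependent second proof no longer drifts when constituents are re-typed under fixed names.
`isChristodoulouGeneric_mono` (topology-free genericity) is kept unchanged. `assemblyT2_frame_proof`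
remains the closing theorem; this module still imports the route module and must not be used as the
item's `_holds` link.
-/

-- `Summit.<Summit>.<Problem>` is the mandated summit-side namespace (CONVENTIONS §2); for the
-- single-conjunct summit `FinalStateConjecture` the two coincide, so the duplicate is deliberate.
set_option linter.dupNamespace false

namespace Summit.FinalStateConjecture.FinalStateConjecture.Theorems

open scoped Manifold ContDiff
open Summit.FinalStateConjecture.FinalStateConjecture.Theses.PhotonSphereChannels

/-- Christodoulou-genericity (relative to an admissible class `𝓓`, codimension `m`) is
monotone in the property: if `Q D → P D` for every `D ∈ 𝓓`, then `Q` generic implies `P`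
generic (the exceptional set of `P` is contained in that of `Q`, and the same smooth injective
admissible family through a `P`-exceptional datum works). -/
theorem isChristodoulouGeneric_mono {E : Type*} [NormedAddCommGroup E] [NormedSpace ℝ E]
    {H : Type*} [TopologicalSpace H] {I : ModelWithCorners ℝ E H} {X : Type*}
    [TopologicalSpace X] [ChartedSpace H X] [IsManifold I ∞ X]
    {𝓓 : Set (Literature.Geometry.Lorentzian.InitialDataSet I X)}
    {P Q : Literature.Geometry.Lorentzian.InitialDataSet I X → Prop} {m : ℕ}
    (hQP : ∀ D ∈ 𝓓, Q D → P D)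
    (hQ : Literature.Geometry.Lorentzian.InitialDataSet.IsChristodoulouGeneric 𝓓 Q m) :
    Literature.Geometry.Lorentzian.InitialDataSet.IsChristodoulouGeneric 𝓓 P m := by
  intro D hD
  obtain ⟨F, hF, h0, hinj, hadm, hexc⟩ := hQ D ⟨hD.1, fun h => hD.2 (hQP D hD.1 h)⟩
  exact ⟨F, hF, h0, hinj, hadm,
    fun c hc hmem => hexc c hc ⟨hmem.1, fun h => hmem.2 (hQP _ hmem.1 h)⟩⟩

/-- **Assembly of route PhotonSphereChannels** (originally the curried item
stmt-FinalStateConjecture-10050 `UniformPhotonSphereChannels → ChannelsResolveTameDevelopments →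
TameCensorship → FinalStateConjecture`, closed by this theorem at d725233c9ffd; since the rev-4
restate under the same decl name it proves the uncurried frame form, item
stmt-FinalStateConjecture-13914 — see the module docstring). Pure logic: genericity is monotone in the property; on admissible data the
tame property gives, via `ChannelsResolveTameDevelopments` applied to `UniformPhotonSphereChannels`,
an honest exhaustive final-state decomposition whose holes are sub-extremal by the
no-extremal-remnant clause. Since route rev 15 (T2 re-type, 2026-08-16T23:19Z; item
stmt-FinalStateConjecture-17432) the proof is the route's deciding theorem `closes`, uncurried. -/
theorem assembly_proof :
    Summit.FinalStateConjecture.FinalStateConjecture.Theses.PhotonSphereChannels.Assembly := by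
  unfold Assembly
  -- rev ≥ 15: `Assembly` is the uncurried frame `K1R ∧ K2R ∧ K3 → FinalStateConjecture` of `closes`
  rintro ⟨h₁, h₂, h₃⟩
  exact closes h₁ h₂ h₃

end Summit.FinalStateConjecture.FinalStateConjecture.Theorems
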